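import Mathlib
import Summits.Ventures.FusionMHD.Models.RwmFRS1EqRes21EtaBase
import Summits.Ventures.FusionMHD.Models.RwmFRS1EqRes21EtaCerts
import HarnessLib

/-!
# F3.σ row «F3.σ-NEWCOMB-RES21-FRS1-EQ-η»: the RESONANT helicity `(m, n) = (2, 1)` of the FORCE-BALANCED MODEL M_RWM,eq
# (`RwmFRS1.Eq.Peq`: `B_z ≡ 1`, `B_θ = r/(7(1+r²))`, FINITE pressure `p′ = −2r/(49(1+r²)³) < 0`, `q = 2` at `r_s = √(3/7)`)
# is INTERNALLY STABLE in Newcomb's sense — the FIRST INSTANCE of lit-4's η-TEMPLATE `η = (r_s − r)^ν · P` (part 3/3: identities + verdict;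
# parts 1/3 `…EtaBase.lean` = profile / φ / brackets, 2/3 `…EtaCerts.lean` = polynomial kernel checks)

LADDER-GRIDFUSION rung F3 (cell `gridfusion`); statements + proofs by gridfusion-lit-4 (g13), 2026-08-28 (lead RULINGS 9es (5a) /
9fu (4): «first INSTANCE of the η-template on a named resonant finite-β profile»).  What is new relative to ★ «RES21-FRS1»
(`RwmFRS1Res21.lean`, the ZERO-β twin `RwmFRS1.P`): here `p′(r_s) ≠ 0`, so Newcomb's `g` is NEGATIVE at the resonance
(`g(r_s) = 2μ₀k²p′/k₀² = −7.8·10⁻⁵`), both Frobenius solutions at `r_s` are singular (indicial exponents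
`ν = (−1 ± √(1 + 4g_s/A))/2 = −0.0345…, −0.9655…`, `A = f″(r_s)/2`; Suydam's `1 + 4g_s/A = 13/15 > 0`), and neither
`w ≡ 1` nor `w = r` is a supersolution next to `r_s`.  The verdict is reached WITHOUT SOLVING by the η-TEMPLATE of
`Literature/Analysis/ODE/ResonantPowerSupersolution.lean` + `Literature/MathematicalPhysics/MHD/NewcombResonantEtaCertificate.lean`
(`stable_oneResonance_of_supersolutions_eta`): regular side `w₁ = r` on `(0, 1/2]`; `η = (r_s − r)^(−1/10)` on `[1/2, r_s)`;
`η = (r − r_s)^(−1/10)` on `(r_s, 1]` (`P ≡ 1` on both templates); matching at `r₀ = 1/2`: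
`(1/10)/(r_s − 1/2) ≤ w₁′/w₁(1/2) = 2`.  The four bracket inequalities (`B ≤ g·P`, `|B| ≤ Q·P` on each side) are
RATIONAL-FUNCTION inequalities in `r` and `r_s`; after clearing the positive denominator `D = 1225(1+r²)³(r²+100)²` each
is a polynomial `P_i(r, r_s) = A_i(r) + r_s·B_i(r) + e_i(r, r_s)·(r_s² − 3/7)` (`linear_combination`), and
`A_i + r_s B_i ≥ 0` follows from the two KERNEL-CHECKED univariate facts `A_i + q·B_i > 0` on the `r`-interval for
`q ∈ {65465/100000, 65466/100000} ∋ r_s` (Taylor-model exclusion leaves of the tree's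
`Literature/Analysis/ValidatedNumerics/TaylorModelZeroCert.lean`, 12 `decide` + kernel; polynomials of degree ≤ 11 with
≤ 8-digit integer coefficients, produced by sympy on kit j308084 and RE-CHECKED here by `ring`/`linear_combination`).
0 kit in the kernel, 0 named facts, no `native_decide`, no `Real.rpow` facts beyond the template's.

## THREE COLUMNS (never merged)
CERTIFIED (kernel, this file): for MODEL M_RWM,eq (`RwmFRS1.Eq.Peq`, by name) and the helicity `(m, k) = (2, −1/5)`
(`(m, n) = (2, 1)` at the DECLARED `R₀ = 5a`): every radial trial displacement `ξ` of Newcomb's admissible class —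
`C¹` on `(−2, 2)` off `r_s`, `ξ(1) = 0`, finite energy (11.115) (`FiniteEnergyOn`) — has reduced ideal energy
`∫₀¹ (f ξ′² + g ξ²) dr ≥ 0`, and `> 0` unless `ξ ≡ 0` on `(r_s, 1]` (`internal_stable_21_eq`).  Ingredients certified
on the way: `w₁ = r` is a supersolution on `(0, 1/2]` (`g·r − f′ = r⁴N(r²)/D`, `N > 0` on `[0, 1/4]`); the η-brackets
with `ν = −1/10` are dominated by `g` with margins `≥ 2733/D` (left) and `≥ 4789/D` (right) and bounded by `(1/100)·P`;
`65465/100000 < r_s < 65466/100000`.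
VALIDATED (never in the kernel; kit j307810 / j307976, floats): Newcomb's test by integration — the solution regular at the
axis has no zero on `(0, r_s)`, the small solution leaving `r_s` has none on `(r_s, 1]` (`ξ(1) = 1.16 ξ(r_s⁺)`); indicial data
`A = 2.3467·10⁻³`, `g_s = −7.8223·10⁻⁵`, `g_s/A = −1/30`; slack of the certified inequalities: `(g r − f′)/r⁴ ≥ 4.7·10⁻³`
on `(0, 1/2]`, `g − B ≥ 8.8·10⁻⁵` on `[1/2, r_s)`, `≥ 1.3·10⁻⁴` on `(r_s, 1]`, `max|B| = 2.1·10⁻⁴ / 1.1·10⁻³ ≤ 1/100`.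
MODELLED: straight periodic cylinder, ideal MHD, the force-balanced FRS1 screw pinch at finite β (Suydam FAILS in the core
`r² < t_S = (√(65/49) − 1)/2 ≈ 0.076` — `TearingFRS1EqSuydam.lean` — so OTHER helicities, resonant in the core, ARE
Newcomb–Suydam unstable; THIS row is the single helicity `(2,1)` whose resonance `r_s² = 3/7` lies where Suydam holds);
«stable» = non-negativity of the reduced one-helicity energy on the admissible class (Newcomb 1960 Theorems 3/7/12 as
printed in Freidberg §11.5.3 / Miyamoto §9.3), no growth rate, no nonlinear statement, nothing about a device or a torus.

Citations: J. P. Freidberg, *Ideal MHD* (CUP 2014) §11.5.1 (11.89)–(11.90), §11.5.3 (11.105)–(11.118) [Freidberg2014];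
K. Miyamoto, *Plasma Physics for Nuclear Fusion* (1979) §9.3c(ii) Theorem 12 [MiyamotoDewar1979]; P. Hartman, *ODE* (2002)
Ch. XI §6 [Hartman2002].  Everything here is [instance data].
-/

noncomputable section

open Real Set
open Literature.MathematicalPhysics.MHD Literature.MathematicalPhysics.MHD.ScrewPinch
open Literature.Analysis.ODE.ResonantPower
open Literature.Analysis.ValidatedNumerics.PolyMP
open Literature.Analysis.ValidatedNumerics.ExpPoly

namespace Summit.Ventures.FusionMHD.Models

namespace RwmFRS1

namespace EqRes21

open Res21 (rs rs_pos rs_sq rs_lt_one fD)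

/-! ### §6′ The identities `D·(…) = A_i + r_s·B_i` (mod `r_s² = 3/7`) and the four bracket inequalities -/

/-- (L1) `D·(g − B_left) = A_L1 + r_s·B_L1` on `r ≠ 0`. [instance data] -/
theorem ident_L1 {r : ℝ} (hr : r ≠ 0) :
    D r * (Eq.Peq.newcombG 2 kk r - (-(9 / 100) * phi r + 1 / 10 * (rs - r) * dphi r))
      = Poly.eval pA_L1 r + rs * Poly.eval pB_L1 r := by
  have h1 : (0 : ℝ) < 1 + r ^ 2 := by positivity
  have h2 : (0 : ℝ) < r ^ 2 + 100 := by positivity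
  have step : D r * (Eq.Peq.newcombG 2 kk r - (-(9 / 100) * phi r + 1 / 10 * (rs - r) * dphi r))
      = (67500 : ℝ) * r - (36750 : ℝ) * r ^ 2 * rs ^ 3 - (258475 : ℝ) * r ^ 3 - (50225 : ℝ) * r ^ 3 * rs ^ 2 + (58800 : ℝ) * r ^ 4 * rs + ((24255 : ℝ) / 2) * r ^ 4 * rs ^ 3 + (121259 : ℝ) * r ^ 5 - ((5929 : ℝ) / 4) * r ^ 5 * rs ^ 2 + (10143 : ℝ) * r ^ 6 * rs + ((735 : ℝ) / 2) * r ^ 6 * rs ^ 3 + ((1599179 : ℝ) / 4) * r ^ 7 + ((931 : ℝ) / 4) * r ^ 7 * rs ^ 2 - (147 : ℝ) * r ^ 8 * rs + ((44079 : ℝ) / 4) * r ^ 9 + (49 : ℝ) * r ^ 11 := by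
    rw [newcombG_eq hr, phi, dphi, D, Res21.G]
    field_simp
    ring
  rw [step]
  simp only [pA_L1, pB_L1, Poly.eval_cons, Poly.eval_nil]
  push_cast
  linear_combination (-(36750 : ℝ) * r ^ 2 * rs - (50225 : ℝ) * r ^ 3 + ((24255 : ℝ) / 2) * r ^ 4 * rs - ((5929 : ℝ) / 4) * r ^ 5 + ((735 : ℝ) / 2) * r ^ 6 * rs + ((931 : ℝ) / 4) * r ^ 7) * rs_sq

/-- (L2a) `D·(1/100 − B_left) = A_L2a + r_s·B_L2a`. [instance data] -/
theorem ident_L2a (r : ℝ) :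
    D r * (1 / 100 - (-(9 / 100) * phi r + 1 / 10 * (rs - r) * dphi r))
      = Poly.eval pA_L2a r + rs * Poly.eval pB_L2a r := by
  have h1 : (0 : ℝ) < 1 + r ^ 2 := by positivity
  have h2 : (0 : ℝ) < r ^ 2 + 100 := by positivity
  have step : D r * (1 / 100 - (-(9 / 100) * phi r + 1 / 10 * (rs - r) * dphi r)) = (122500 : ℝ) + (369950 : ℝ) * r ^ 2 - (36750 : ℝ) * r ^ 2 * rs ^ 3 - (50225 : ℝ) * r ^ 3 * rs ^ 2 + ((1499449 : ℝ) / 4) * r ^ 4 + (58800 : ℝ) * r ^ 4 * rs + ((24255 : ℝ) / 2) * r ^ 4 * rs ^ 3 + (72275 : ℝ) * r ^ 5 - ((5929 : ℝ) / 4) * r ^ 5 * rs ^ 2 + ((519547 : ℝ) / 4) * r ^ 6 + (10143 : ℝ) * r ^ 6 * rs + ((735 : ℝ) / 2) * r ^ 6 * rs ^ 3 + ((95011 : ℝ) / 4) * r ^ 7 + ((931 : ℝ) / 4) * r ^ 7 * rs ^ 2 + ((9947 : ℝ) / 4) * r ^ 8 - (147 : ℝ) * r ^ 8 * rs - ((49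 : ℝ) / 4) * r ^ 9 + ((49 : ℝ) / 4) * r ^ 10 := by
    rw [phi, dphi, D]
    field_simp
    ring
  rw [step]
  simp only [pA_L2a, pB_L2a, Poly.eval_cons, Poly.eval_nil]
  push_cast
  linear_combination (-(36750 : ℝ) * r ^ 2 * rs - (50225 : ℝ) * r ^ 3 + ((24255 : ℝ) / 2) * r ^ 4 * rs - ((5929 : ℝ) / 4) * r ^ 5 + ((735 : ℝ) / 2) * r ^ 6 * rs + ((931 : ℝ) / 4) * r ^ 7) * rs_sq

/-- (L2b) `D·(1/100 + B_left) = A_L2b + r_s·B_L2b`. [instance data] -/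
theorem ident_L2b (r : ℝ) :
    D r * (1 / 100 + (-(9 / 100) * phi r + 1 / 10 * (rs - r) * dphi r))
      = Poly.eval pA_L2b r + rs * Poly.eval pB_L2b r := by
  have h1 : (0 : ℝ) < 1 + r ^ 2 := by positivity
  have h2 : (0 : ℝ) < r ^ 2 + 100 := by positivity
  have step : D r * (1 / 100 + (-(9 / 100) * phi r + 1 / 10 * (rs - r) * dphi r)) = (122500 : ℝ) + (369950 : ℝ) * r ^ 2 + (36750 : ℝ) * r ^ 2 * rs ^ 3 + (50225 : ℝ) * r ^ 3 * rs ^ 2 + ((1499449 : ℝ) / 4) * r ^ 4 - (58800 : ℝ) * r ^ 4 * rs - ((24255 : ℝ) / 2) * r ^ 4 * rs ^ 3 - (72275 : ℝ) * r ^ 5 + ((5929 : ℝ) / 4) * r ^ 5 * rs ^ 2 + ((519547 : ℝ) / 4) * r ^ 6 - (10143 : ℝ) * r ^ 6 * rs - ((735 : ℝ) / 2) * r ^ 6 * rs ^ 3 - ((95011 : ℝ) / 4) * r ^ 7 - ((931 : ℝ) / 4) * r ^ 7 * rs ^ 2 + ((9947 : ℝ) / 4) * r ^ 8 + (147 : ℝ)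 * r ^ 8 * rs + ((49 : ℝ) / 4) * r ^ 9 + ((49 : ℝ) / 4) * r ^ 10 := by
    rw [phi, dphi, D]
    field_simp
    ring
  rw [step]
  simp only [pA_L2b, pB_L2b, Poly.eval_cons, Poly.eval_nil]
  push_cast
  linear_combination ((36750 : ℝ) * r ^ 2 * rs + (50225 : ℝ) * r ^ 3 - ((24255 : ℝ) / 2) * r ^ 4 * rs + ((5929 : ℝ) / 4) * r ^ 5 - ((735 : ℝ) / 2) * r ^ 6 * rs - ((931 : ℝ) / 4) * r ^ 7) * rs_sq

/-- (R1) `D·(g − B_right) = A_R1 + r_s·B_R1` on `r ≠ 0`. [instance data] -/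
theorem ident_R1 {r : ℝ} (hr : r ≠ 0) :
    D r * (Eq.Peq.newcombG 2 kk r - (-(9 / 100) * phi r - 1 / 10 * (r - rs) * dphi r))
      = Poly.eval pA_R1 r + rs * Poly.eval pB_R1 r := by
  have h1 : (0 : ℝ) < 1 + r ^ 2 := by positivity
  have h2 : (0 : ℝ) < r ^ 2 + 100 := by positivity
  have step : D r * (Eq.Peq.newcombG 2 kk r - (-(9 / 100) * phi r - 1 / 10 * (r - rs) * dphi r))
      = (67500 : ℝ) * r - (36750 : ℝ) * r ^ 2 * rs ^ 3 - (258475 : ℝ) * r ^ 3 - (50225 : ℝ) * r ^ 3 * rs ^ 2 + (58800 : ℝ) * r ^ 4 * rs + ((24255 : ℝ) / 2) * r ^ 4 * rs ^ 3 + (121259 : ℝ) * r ^ 5 - ((5929 : ℝ) / 4) * r ^ 5 * rs ^ 2 + (10143 : ℝ) * r ^ 6 * rs + ((735 : ℝ) / 2) * r ^ 6 * rs ^ 3 + ((1599179 : ℝ) / 4) * r ^ 7 + ((931 : ℝ) / 4) * r ^ 7 * rs ^ 2 - (147 : ℝ) * r ^ 8 * rs + ((44079 : ℝ) / 4) * r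 ^ 9 + (49 : ℝ) * r ^ 11 := by
    rw [newcombG_eq hr, phi, dphi, D, Res21.G]
    field_simp
    ring
  rw [step]
  simp only [pA_R1, pB_R1, Poly.eval_cons, Poly.eval_nil]
  push_cast
  linear_combination (-(36750 : ℝ) * r ^ 2 * rs - (50225 : ℝ) * r ^ 3 + ((24255 : ℝ) / 2) * r ^ 4 * rs - ((5929 : ℝ) / 4) * r ^ 5 + ((735 : ℝ) / 2) * r ^ 6 * rs + ((931 : ℝ) / 4) * r ^ 7) * rs_sq

/-- (R2a) `D·(1/100 − B_right) = A_R2a + r_s·B_R2a`. [instance data] -/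
theorem ident_R2a (r : ℝ) :
    D r * (1 / 100 - (-(9 / 100) * phi r - 1 / 10 * (r - rs) * dphi r))
      = Poly.eval pA_R2a r + rs * Poly.eval pB_R2a r := by
  have h1 : (0 : ℝ) < 1 + r ^ 2 := by positivity
  have h2 : (0 : ℝ) < r ^ 2 + 100 := by positivity
  have step : D r * (1 / 100 - (-(9 / 100) * phi r - 1 / 10 * (r - rs) * dphi r)) = (122500 : ℝ) + (369950 : ℝ) * r ^ 2 - (36750 : ℝ) * r ^ 2 * rs ^ 3 - (50225 : ℝ) * r ^ 3 * rs ^ 2 + ((1499449 : ℝ) / 4) * r ^ 4 + (58800 : ℝ) * r ^ 4 * rs + ((24255 : ℝ) / 2) * r ^ 4 * rs ^ 3 + (72275 : ℝ) * r ^ 5 - ((5929 : ℝ) / 4) * r ^ 5 * rs ^ 2 + ((519547 : ℝ) / 4) * r ^ 6 + (10143 : ℝ) * r ^ 6 * rs + ((735 : ℝ) / 2) * r ^ 6 * rs ^ 3 + ((95011 : ℝ) / 4) * r ^ 7 + ((931 : ℝ) / 4) * r ^ 7 * rs ^ 2 + ((9947 : ℝ) / 4) * r ^ 8 - (147 : ℝ)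 * r ^ 8 * rs - ((49 : ℝ) / 4) * r ^ 9 + ((49 : ℝ) / 4) * r ^ 10 := by
    rw [phi, dphi, D]
    field_simp
    ring
  rw [step]
  simp only [pA_R2a, pB_R2a, Poly.eval_cons, Poly.eval_nil]
  push_cast
  linear_combination (-(36750 : ℝ) * r ^ 2 * rs - (50225 : ℝ) * r ^ 3 + ((24255 : ℝ) / 2) * r ^ 4 * rs - ((5929 : ℝ) / 4) * r ^ 5 + ((735 : ℝ) / 2) * r ^ 6 * rs + ((931 : ℝ) / 4) * r ^ 7) * rs_sq

/-- (R2b) `D·(1/100 + B_right) = A_R2b + r_s·B_R2b`. [instance data] -/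
theorem ident_R2b (r : ℝ) :
    D r * (1 / 100 + (-(9 / 100) * phi r - 1 / 10 * (r - rs) * dphi r))
      = Poly.eval pA_R2b r + rs * Poly.eval pB_R2b r := by
  have h1 : (0 : ℝ) < 1 + r ^ 2 := by positivity
  have h2 : (0 : ℝ) < r ^ 2 + 100 := by positivity
  have step : D r * (1 / 100 + (-(9 / 100) * phi r - 1 / 10 * (r - rs) * dphi r)) = (122500 : ℝ) + (369950 : ℝ) * r ^ 2 + (36750 : ℝ) * r ^ 2 * rs ^ 3 + (50225 : ℝ) * r ^ 3 * rs ^ 2 + ((1499449 : ℝ) / 4) * r ^ 4 - (58800 : ℝ) * r ^ 4 * rs - ((24255 : ℝ) / 2) * r ^ 4 * rs ^ 3 - (72275 : ℝ) * r ^ 5 + ((5929 : ℝ) / 4) * r ^ 5 * rs ^ 2 + ((519547 : ℝ) / 4) * r ^ 6 - (10143 : ℝ) * r ^ 6 * rs - ((735 : ℝ) / 2) * r ^ 6 * rs ^ 3 - ((95011 : ℝ) / 4) * r ^ 7 - ((931 : ℝ) / 4) * r ^ 7 * rs ^ 2 + ((9947 : ℝ) / 4) * r ^ 8 + (147 : ℝ)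 * r ^ 8 * rs + ((49 : ℝ) / 4) * r ^ 9 + ((49 : ℝ) / 4) * r ^ 10 := by
    rw [phi, dphi, D]
    field_simp
    ring
  rw [step]
  simp only [pA_R2b, pB_R2b, Poly.eval_cons, Poly.eval_nil]
  push_cast
  linear_combination ((36750 : ℝ) * r ^ 2 * rs + (50225 : ℝ) * r ^ 3 - ((24255 : ℝ) / 2) * r ^ 4 * rs + ((5929 : ℝ) / 4) * r ^ 5 - ((735 : ℝ) / 2) * r ^ 6 * rs - ((931 : ℝ) / 4) * r ^ 7) * rs_sq

/-- `A + r_s B > 0` from the two kernel facts on an `r`-interval. [instance data] -/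
theorem pos_AB {pA pB cl ch : Poly} {a b : ℚ} {r : ℝ}
    (hl : ∀ t ∈ Icc ((a : ℝ)) ((b : ℝ)), 0 < Poly.eval cl t) (hh : ∀ t ∈ Icc ((a : ℝ)) ((b : ℝ)), 0 < Poly.eval ch t)
    (el : ∀ t : ℝ, Poly.eval cl t = Poly.eval pA t + ((13093 : ℝ) / 20000) * Poly.eval pB t)
    (eh : ∀ t : ℝ, Poly.eval ch t = Poly.eval pA t + ((32733 : ℝ) / 50000) * Poly.eval pB t)
    (hr : r ∈ Icc ((a : ℝ)) ((b : ℝ))) : 0 < Poly.eval pA r + rs * Poly.eval pB r :=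
  pos_of_endpoints (by rw [← el]; exact hl r hr) (by rw [← eh]; exact hh r hr) rs_gt.le rs_lt.le

/-- **LEFT TEMPLATE IS A SUPERSOLUTION**: `B ≤ g·1` on `(1/2, r_s)`. [instance data] -/
theorem bracketL_le {r : ℝ} (hr : r ∈ Ioo (1 / 2 : ℝ) rs) :
    etaBracket rs (-1 / 10) phi dphi (fun _ => (1 : ℝ)) (fun _ => (0 : ℝ)) (fun _ => (0 : ℝ)) r
      ≤ Eq.Peq.newcombG 2 kk r * 1 := by
  rw [etaBracket_eq, mul_one]
  have hr0 : r ≠ 0 := by linarith [hr.1]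
  have hI : r ∈ Icc ((((1 : ℚ) / 2 : ℚ) : ℝ)) ((((32733 : ℚ) / 50000 : ℚ) : ℝ)) :=
    ⟨by push_cast; linarith [hr.1], by push_cast; linarith [hr.2, rs_lt]⟩
  have hpos := pos_AB pos_cL1lo pos_cL1hi eval_cL1lo eval_cL1hi hI
  rw [← ident_L1 hr0] at hpos
  have hD := D_pos r
  by_contra hcon
  have : Eq.Peq.newcombG 2 kk r - (-(9 / 100) * phi r + 1 / 10 * (rs - r) * dphi r) < 0 := by linarith [not_le.1 hcon]
  nlinarith

/-- `|B| ≤ (1/100)·1` on `[1/2, r_s)` (left). [instance data] -/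
theorem bracketL_abs {r : ℝ} (hr : r ∈ Ico (1 / 2 : ℝ) rs) :
    |etaBracket rs (-1 / 10) phi dphi (fun _ => (1 : ℝ)) (fun _ => (0 : ℝ)) (fun _ => (0 : ℝ)) r| ≤ 1 / 100 * 1 := by
  rw [etaBracket_eq, mul_one, abs_le]
  have hI : r ∈ Icc ((((1 : ℚ) / 2 : ℚ) : ℝ)) ((((32733 : ℚ) / 50000 : ℚ) : ℝ)) :=
    ⟨by push_cast; linarith [hr.1], by push_cast; linarith [hr.2, rs_lt]⟩
  have ha := pos_AB pos_cL2alo pos_cL2ahi eval_cL2alo eval_cL2ahi hI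
  have hb := pos_AB pos_cL2blo pos_cL2bhi eval_cL2blo eval_cL2bhi hI
  rw [← ident_L2a r] at ha
  rw [← ident_L2b r] at hb
  have hD := D_pos r
  constructor
  · by_contra hcon
    have : 1 / 100 + (-(9 / 100) * phi r + 1 / 10 * (rs - r) * dphi r) < 0 := by linarith [not_le.1 hcon]
    nlinarith
  · by_contra hcon
    have : 1 / 100 - (-(9 / 100) * phi r + 1 / 10 * (rs - r) * dphi r) < 0 := by linarith [not_le.1 hcon]
    nlinarith

/-- **RIGHT TEMPLATE IS A SUPERSOLUTION**: `B ≤ g·1` on `(r_s, 1)`. [instance data] -/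
theorem bracketR_le {r : ℝ} (hr : r ∈ Ioo rs (1 : ℝ)) :
    etaBracketR rs (-1 / 10) phi dphi (fun _ => (1 : ℝ)) (fun _ => (0 : ℝ)) (fun _ => (0 : ℝ)) r
      ≤ Eq.Peq.newcombG 2 kk r * 1 := by
  rw [etaBracketR_eq, mul_one]
  have hr0 : r ≠ 0 := by linarith [hr.1, rs_pos]
  have hI : r ∈ Icc ((((13093 : ℚ) / 20000 : ℚ) : ℝ)) (((1 : ℚ) : ℝ)) :=
    ⟨by push_cast; linarith [hr.1, rs_gt], by push_cast; linarith [hr.2]⟩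
  have hpos := pos_AB pos_cR1lo pos_cR1hi eval_cR1lo eval_cR1hi hI
  rw [← ident_R1 hr0] at hpos
  have hD := D_pos r
  by_contra hcon
  have : Eq.Peq.newcombG 2 kk r - (-(9 / 100) * phi r - 1 / 10 * (r - rs) * dphi r) < 0 := by linarith [not_le.1 hcon]
  nlinarith

/-- `|B| ≤ (1/100)·1` on `(r_s, 1]` (right). [instance data] -/
theorem bracketR_abs {r : ℝ} (hr : r ∈ Ioc rs (1 : ℝ)) :
    |etaBracketR rs (-1 / 10) phi dphi (fun _ => (1 : ℝ)) (fun _ => (0 : ℝ)) (fun _ => (0 : ℝ)) r| ≤ 1 / 100 * 1 := by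
  rw [etaBracketR_eq, mul_one, abs_le]
  have hI : r ∈ Icc ((((13093 : ℚ) / 20000 : ℚ) : ℝ)) (((1 : ℚ) : ℝ)) :=
    ⟨by push_cast; linarith [hr.1, rs_gt], by push_cast; linarith [hr.2]⟩
  have ha := pos_AB pos_cR2alo pos_cR2ahi eval_cR2alo eval_cR2ahi hI
  have hb := pos_AB pos_cR2blo pos_cR2bhi eval_cR2blo eval_cR2bhi hI
  rw [← ident_R2a r] at ha
  rw [← ident_R2b r] at hb
  have hD := D_pos r
  constructor
  · by_contra hcon
    have : 1 / 100 + (-(9 / 100) * phi r - 1 / 10 * (r - rs) * dphi r) < 0 := by linarith [not_le.1 hcon]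
    nlinarith
  · by_contra hcon
    have : 1 / 100 - (-(9 / 100) * phi r - 1 / 10 * (r - rs) * dphi r) < 0 := by linarith [not_le.1 hcon]
    nlinarith

/-! ### §7 The verdict -/

/-- The bracket functions are continuous (rational functions with positive denominators). [instance data] -/
theorem continuous_bracketL :
    Continuous (etaBracket rs (-1 / 10) phi dphi (fun _ => (1 : ℝ)) (fun _ => (0 : ℝ)) (fun _ => (0 : ℝ))) := by
  have e : etaBracket rs (-1 / 10) phi dphi (fun _ => (1 : ℝ)) (fun _ => (0 : ℝ)) (fun _ => (0 : ℝ))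
      = fun r => -(9 / 100) * phi r + 1 / 10 * (rs - r) * dphi r := funext etaBracket_eq
  rw [e]
  have := continuous_phi
  have := continuous_dphi
  fun_prop

/-- Continuity of the right bracket. [instance data] -/
theorem continuous_bracketR :
    Continuous (etaBracketR rs (-1 / 10) phi dphi (fun _ => (1 : ℝ)) (fun _ => (0 : ℝ)) (fun _ => (0 : ℝ))) := by
  have e : etaBracketR rs (-1 / 10) phi dphi (fun _ => (1 : ℝ)) (fun _ => (0 : ℝ)) (fun _ => (0 : ℝ))
      = fun r => -(9 / 100) * phi r - 1 / 10 * (r - rs) * dphi r := funext etaBracketR_eq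
  rw [e]
  have := continuous_phi
  have := continuous_dphi
  fun_prop

/-- The matching inequality at `r₀ = 1/2`: `η′/η(1/2) = (1/10)/(r_s − 1/2) ≤ 2 = w₁′/w₁(1/2)`. [instance data] -/
theorem matching :
    (-(-1 / 10 : ℝ) * (fun _ : ℝ => (1 : ℝ)) (1 / 2) + (rs - 1 / 2) * (fun _ : ℝ => (0 : ℝ)) (1 / 2))
        / ((rs - 1 / 2) * (fun _ : ℝ => (1 : ℝ)) (1 / 2))
      ≤ deriv (fun y : ℝ => y) (1 / 2) / (fun y : ℝ => y) (1 / 2) := by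
  simp only [mul_one, mul_zero, add_zero, deriv_id'']
  have h : (1 : ℝ) / 20 < rs - 1 / 2 := by linarith [rs_gt]
  rw [div_le_iff₀ (by linarith)]
  norm_num
  linarith

/-- **INTERNAL `(2,1)` MODES OF THE FORCE-BALANCED MODEL M_RWM,eq ARE STABLE IN NEWCOMB'S SENSE although `q = 2` lies
inside the plasma AND `p′ < 0` there** (first instance of the η-template): every admissible displacement (`C¹` on
`(−2, 2)` off `r_s`, `ξ(1) = 0`, finite energy (11.115)) has reduced energy `≥ 0`, and `> 0` unless it vanishes on
`(r_s, 1]`.  MODELLED: straight cylinder, ideal MHD, one helicity; nothing about a device. [instance data] -/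
theorem internal_stable_21_eq :
    ∀ ξ : ℝ → ℝ, ContDiffOn ℝ 1 ξ (Ioo (-2) 2 \ {rs}) → ξ 1 = 0 → Eq.Peq.FiniteEnergyOn 2 kk 0 1 ξ →
      0 ≤ Eq.Peq.fluidEnergy 2 kk 1 ξ ∧ ((∃ r ∈ Ioc rs 1, ξ r ≠ 0) → 0 < Eq.Peq.fluidEnergy 2 kk 1 ξ) := by
  obtain ⟨hBθ, hBz, hp, hBθ0⟩ := Eq.profile_regular 2
  have hr₀ : (0 : ℝ) < 1 / 2 := by norm_num
  have hr₀ₛ : (1 : ℝ) / 2 < rs := by linarith [rs_gt]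
  have hfDc : Continuous fD := by
    unfold Res21.fD
    exact Continuous.div (by fun_prop) (by fun_prop) fun x => by positivity
  refine Profile.stable_oneResonance_of_supersolutions_eta (P := Eq.Peq) (m := 2) (k := kk) (a := 1) (b := 2)
    (rₛ := rs) (r₀ := 1 / 2) (r₂' := 1 / 4) (a' := 3 / 2) (ν := -1 / 10) (νo := -1 / 10)
    (Q₁ := 1) (Q₂ := 1 / 100) (Q := 1 / 100)
    (w₁ := fun y => y) (q₁ := fD) (φ := phi) (φ' := dphi)
    (P₂ := fun _ => 1) (P₂' := fun _ => 0) (P₂'' := fun _ => 0)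
    (φo := phi) (φo' := dphi) (Po := fun _ => 1) (Po' := fun _ => 0) (Po'' := fun _ => 0)
    hr₀ hr₀ₛ rs_lt_one (by norm_num) two_ne_zero hBθ hBz hp hBθ0 ?_ ?_ ?_
    contDiffOn_id (fun r hr => hr.1) hfDc.continuousOn
    (fun r hr => Res21.abs_fD_le hr.1 (by linarith [hr.2]))
    (fun r hr => hasDerivAt_fw hr.1) (fun r hr => fD_le hr)
    (by norm_num) (fun r hr => newcombF_fact (by linarith [hr.1] : (0:ℝ) < r).ne')
    (fun r _ => hasDerivAt_phi r) (fun r _ => hasDerivAt_const r (1 : ℝ)) (fun r _ => hasDerivAt_const r (0 : ℝ))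
    contDiffOn_const (fun _ _ => one_pos) continuous_bracketL.continuousOn
    (fun r hr => bracketL_le hr) (fun r hr => bracketL_abs hr) matching
    (by norm_num) (fun r hr => newcombF_factR (rs_pos.trans hr.1).ne')
    (fun r _ => hasDerivAt_phi r) (fun r _ => hasDerivAt_const r (1 : ℝ)) (fun r _ => hasDerivAt_const r (0 : ℝ))
    contDiffOn_const (fun _ _ => one_pos) continuous_bracketR.continuousOn
    (fun r hr => bracketR_le hr) (fun r hr => bracketR_abs hr)
  · rw [kDotB_eq_P]; exact Res21.kDotB_rs
  · intro r hr; rw [kDotB_eq_P]; exact Res21.kDotB_ne_zero_in hr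
  · intro r hr; rw [kDotB_eq_P]; exact Res21.kDotB_ne_zero_out hr.1

/-- **EXTERNAL `(2,1)` MODES OF THE FORCE-BALANCED MODEL M_RWM,eq ARE STABLE FOR EVERY WALL FACTOR `Λ ≥ 0`** (resonance
inside, `p′ < 0`; Freidberg's (11.118) over the last sub-interval with the η-template `w = (r − r_s)^(−1/10)`:
`f(1)·w′(1)/w(1) + F F†/k₀²(1) = (4/4949)·(−1/10)/(1 − r_s) + 24/4949 > 0`): every admissible external displacement
(`C¹` off `r_s`, finite energy, `ξ(1) ≠ 0`) has positive external-mode energy (11.98) — the finite-β twin of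
`Res21.external_stable_21`, by lit-4's `externalPos_oneResonance_of_supersolutions_eta` (Literature append p633855).
MODELLED: straight cylinder, ideal MHD, vacuum region and a wall encoded by `Λ`; nothing about a device. [instance data] -/
theorem external_stable_21_eq {Λ : ℝ} (hΛ : 0 ≤ Λ) :
    ∀ ξ : ℝ → ℝ, ContDiffOn ℝ 1 ξ (Ioo (-2) 2 \ {rs}) → Eq.Peq.FiniteEnergyOn 2 kk 0 1 ξ →
      ξ 1 ≠ 0 → 0 < Eq.Peq.externalEnergy 2 kk 1 Λ ξ := by
  obtain ⟨hBθ, hBz, hp, hBθ0⟩ := Eq.profile_regular 2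
  have hr₀ : (0 : ℝ) < 1 / 2 := by norm_num
  have hr₀ₛ : (1 : ℝ) / 2 < rs := by linarith [rs_gt]
  have hfDc : Continuous fD := by
    unfold Res21.fD
    exact Continuous.div (by fun_prop) (by fun_prop) fun x => by positivity
  have hf1 : Eq.Peq.newcombF 2 kk 1 = 4 / 4949 := by
    rw [newcombF_eq_P, Res21.newcombF_eq one_ne_zero]; norm_num
  have hF1 : Eq.Peq.kDotB 2 kk 1 = -(2 / 35) := by
    rw [kDotB_eq_P, Res21.kDotB_eq one_ne_zero]; norm_num
  have hFd1 : Eq.Peq.kDotBDagger 2 kk 1 = -(12 / 35) := by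
    rw [kDotBDagger_eq_P, Res21.kDotBDagger_eq one_ne_zero]; norm_num
  have hk1 : ScrewPinch.Profile.k0Sq 2 kk 1 = 101 / 25 := by
    rw [Kq07.k0Sq_eq one_ne_zero]; norm_num
  have h1 : 0 < 1 - rs := by linarith [rs_lt_one]
  have hB : -1 ≤ (-1 / 10 : ℝ) / (1 - rs) := by
    rw [le_div_iff₀ h1]; linarith [rs_lt]
  have hW : 0 < Eq.Peq.newcombF 2 kk 1
        * ((-1 / 10 * (fun _ : ℝ => (1 : ℝ)) 1 + (1 - rs) * (fun _ : ℝ => (0 : ℝ)) 1) / ((1 - rs) * (fun _ : ℝ => (1 : ℝ)) 1))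
      + (Eq.Peq.kDotB 2 kk 1 * Eq.Peq.kDotBDagger 2 kk 1 / ScrewPinch.Profile.k0Sq 2 kk 1
        + 1 ^ 2 * Eq.Peq.kDotB 2 kk 1 ^ 2 * Λ / 2) := by
    simp only [mul_one, mul_zero, add_zero, hf1, hF1, hFd1, hk1]
    nlinarith [hB, hΛ]
  refine Profile.externalPos_oneResonance_of_supersolutions_eta (P := Eq.Peq) (m := 2) (k := kk) (a := 1) (b := 2)
    (rₛ := rs) (r₀ := 1 / 2) (r₂' := 1 / 4) (a' := 3 / 2) (ν := -1 / 10) (νo := -1 / 10)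
    (Q₁ := 1) (Q₂ := 1 / 100) (Q := 1 / 100)
    (w₁ := fun y => y) (q₁ := fD) (φ := phi) (φ' := dphi)
    (P₂ := fun _ => 1) (P₂' := fun _ => 0) (P₂'' := fun _ => 0)
    (φo := phi) (φo' := dphi) (Po := fun _ => 1) (Po' := fun _ => 0) (Po'' := fun _ => 0)
    hr₀ hr₀ₛ rs_lt_one (by norm_num) two_ne_zero hBθ hBz hp hBθ0 ?_ ?_ ?_
    contDiffOn_id (fun r hr => hr.1) hfDc.continuousOn
    (fun r hr => Res21.abs_fD_le hr.1 (by linarith [hr.2]))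
    (fun r hr => hasDerivAt_fw hr.1) (fun r hr => fD_le hr)
    (by norm_num) (fun r hr => newcombF_fact (by linarith [hr.1] : (0:ℝ) < r).ne')
    (fun r _ => hasDerivAt_phi r) (fun r _ => hasDerivAt_const r (1 : ℝ)) (fun r _ => hasDerivAt_const r (0 : ℝ))
    contDiffOn_const (fun _ _ => one_pos) continuous_bracketL.continuousOn
    (fun r hr => bracketL_le hr) (fun r hr => bracketL_abs hr) matching
    (by norm_num) (fun r hr => newcombF_factR (rs_pos.trans hr.1).ne')
    (fun r _ => hasDerivAt_phi r) (fun r _ => hasDerivAt_const r (1 : ℝ)) (fun r _ => hasDerivAt_const r (0 : ℝ))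
    contDiffOn_const (fun _ _ => one_pos) continuous_bracketR.continuousOn
    (fun r hr => bracketR_le hr) (fun r hr => bracketR_abs hr) Λ hW
  · rw [kDotB_eq_P]; exact Res21.kDotB_rs
  · intro r hr; rw [kDotB_eq_P]; exact Res21.kDotB_ne_zero_in hr
  · intro r hr; rw [kDotB_eq_P]; exact Res21.kDotB_ne_zero_out hr.1

end EqRes21

end RwmFRS1

end Summit.Ventures.FusionMHD.Models

end
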